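import Mathlib
import Summits.Ventures.PercRepro2.Defs
import Summits.Ventures.PercRepro2.Graph
import Summits.Ventures.PercRepro2.OneColourSwitch
import Summits.Ventures.PercRepro2.M9SubcubeHarris
import Summits.Ventures.PercRepro2.M9ClusterFibreHarris
import Summits.Ventures.PercRepro2.M9PocketUnitFibreSum
import Summits.Ventures.PercRepro2.M9PocketPsi2Sign

/-!
# The normalisation of a `K`-only point: the `W`-side switched to the `Y`-side (blind cell
PercRepro2, p3 g39, 2026-08-29; `proofs/P3-POCKETRK.md` §10 (d): the free-block extension,
part 7 — the skeleton map, pointwise)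

For a `K`-only legal point `ω` (`Sep ∧ DOne`, `d ∈ K₂ ∖ M₂`) let `W = M₂(G − d) ∖ {r, s}` be its
`W`-side (the `W`-side free blocks) and `ω₁ = ω ⊕ touches W` the point with the `W`-side
switched to the `Y`-side.  The `W`-side is closed in the sided set of `G − d`
(`closedIn_wside`), so `K₂(G − d; ω₁) = K₂(G − d; ω) ∪ W` and `M₂(G − d; ω₁) ⊆ {r, s}`
(`K2_endsD_norm`, `M2_endsD_norm`).  In `G`: every outside vertex of the cluster of `d` at
`ω₁` is in the cluster at `ω` (`cluster_norm_subset`), `r` and `s` have no closed edge at `ω₁`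
(`cluster_compl_mark_norm`), `K₂(ω₁) ⊆ K₂(ω) ∪ W` (`K2_norm_subset`), and `ω₁` is a `K`-only
legal point (`norm_legal`).  Own work; std axioms.
-/

namespace Summit.Ventures.PercRepro2

namespace NoPocket

open Finset Classical OneColourSwitch SideSwitch

variable {V : Type*} {E : Type*} {ends : E → Sym2 V} {p q r s d : V} {ω : Config E}

section Norm

variable (hdr : d ≠ r) (hds : d ≠ s) (hrs : within ends ({r, s} : Set V) = ∅)
  (hT : ∀ e, ends e ≠ s(d, r) ∧ ends e ≠ s(d, s))
  (hsep : sep2 ends p q r s ω) (hD : DOne ends r s d ω) (hK : d ∈ K2 ends r s ω)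
  (hM : d ∉ M2 ends r s ω)

include hdr hds hD in
/-- The `W`-side of `G − d` is closed in the sided set (adjacent sided vertices have the same
side). -/
lemma closedIn_wside :
    ClosedIn (endsD ends d) (sided (endsD ends d) r s ω)
      {x : V | x ∈ M2 (endsD ends d) r s ω ∧ x ≠ r ∧ x ≠ s} := by
  intro e x y hxy ⟨hxM, hxr, hxs⟩ ⟨hyU, hyr, hys⟩
  refine ⟨?_, hyr, hys⟩
  have hDz := DZero_endsD_of_DOne hdr hds hD
  rcases hyU with hyK | hyM
  · exfalso
    cases h : ω e
    · exact hDz y hyr hys hyK (mem_M2_of_closed hxM h hxy)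
    · exact hDz x hxr hxs (mem_K2_of_open hyK h (by rw [hxy, Sym2.eq_swap])) hxM
  · exact hyM

include hdr hds hsep hD in
/-- The `Y`-world of `G − d` after the switch: the old `Y`-world together with the `W`-side. -/
lemma K2_endsD_norm :
    K2 (endsD ends d) r s (flipTouch (endsD ends d)
      {x : V | x ∈ M2 (endsD ends d) r s ω ∧ x ≠ r ∧ x ≠ s} ω) =
      K2 (endsD ends d) r s ω ∪ {x : V | x ∈ M2 (endsD ends d) r s ω ∧ x ≠ r ∧ x ≠ s} := by
  rw [K2_flipTouch_of_closed (sep2_endsD_of_sep2 hsep) (fun x hx => Or.inr hx.1)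
    (fun h => h.2.1 rfl) (fun h => h.2.2 rfl) (closedIn_wside hdr hds hD)]
  ext x
  simp only [Set.mem_union, Set.mem_sdiff, Set.mem_inter_iff, Set.mem_setOf_eq]
  constructor
  · rintro (⟨h, _⟩ | ⟨h, _⟩)
    · exact Or.inl h
    · exact Or.inr h
  · rintro (h | h)
    · by_cases hx : x ∈ M2 (endsD ends d) r s ω ∧ x ≠ r ∧ x ≠ s
      · exact Or.inr ⟨hx, hx.1⟩
      · exact Or.inl ⟨h, hx⟩
    · exact Or.inr ⟨h, h.1⟩

include hdr hds hsep hD in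
/-- The `W`-world of `G − d` after the switch is inside `{r, s}`. -/
lemma M2_endsD_norm :
    ∀ x ∈ M2 (endsD ends d) r s (flipTouch (endsD ends d)
      {x : V | x ∈ M2 (endsD ends d) r s ω ∧ x ≠ r ∧ x ≠ s} ω), x = r ∨ x = s := by
  intro x hx
  rw [M2_flipTouch_of_closed (sep2_endsD_of_sep2 hsep) (fun x hx => Or.inr hx.1)
    (fun h => h.2.1 rfl) (fun h => h.2.2 rfl) (closedIn_wside hdr hds hD)] at hx
  rcases hx with ⟨hxM, hxW⟩ | ⟨hxW, hxK⟩
  · by_contra h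
    exact hxW ⟨hxM, fun h' => h (Or.inl h'), fun h' => h (Or.inr h')⟩
  · exfalso
    exact DZero_endsD_of_DOne hdr hds hD x hxW.2.1 hxW.2.2 hxK hxW.1

include hdr hds hD hK in
/-- An edge from the `W`-side to a vertex outside the worlds of `G − d` is `Y` at `ω`, and its
outside endpoint is not in the cluster of `d` (it would be doubly reached). -/
lemma wside_attachment {e : E} {x y : V} (hxy : ends e = s(x, y))
    (hx : x ∈ M2 (endsD ends d) r s ω ∧ x ≠ r ∧ x ≠ s)
    (hy : y ∉ K2 (endsD ends d) r s ω) (hyM : y ∉ M2 (endsD ends d) r s ω) (hyd : y ≠ d) :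
    ω e = true ∧ y ∉ cluster ends ω d := by
  have hxd : x ≠ d := by rintro rfl; exact not_mem_M2_endsD hdr hds ω hx.1
  have hde : d ∉ ends e := notMem_of_ends_ne hxy hxd hyd
  have he : ω e = true := by
    cases h : ω e
    · exact (hyM (mem_M2_of_closed hx.1 h (by rw [endsD_of_notMem hde, hxy]))).elim
    · rfl
  refine ⟨he, fun hyC => ?_⟩
  -- `x` is `Y`-joined to `y ∈ C_Y(d)`, hence in `K₂(G)`, and in `M₂(G)`: doubly reached
  have hxK : x ∈ K2 ends r s ω := by
    have hdy : Conn ends ω d y := hyC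
    have hyx : Conn ends ω y x := conn_of_openAdj ⟨e, he, by rw [hxy, Sym2.eq_swap]⟩
    rcases mem_K2_iff.1 hK with hc | hc
    · exact mem_K2_iff.2 (Or.inl (conn_trans hc (conn_trans hdy hyx)))
    · exact mem_K2_iff.2 (Or.inr (conn_trans hc (conn_trans hdy hyx)))
  exact hD x hx.2.1 hx.2.2 hxd hxK (M2_endsD_subset_M2 ω hx.1)

include hdr hds hsep hD hK hM in
/-- **Every outside vertex of the cluster of `d` after the switch is in the cluster before**:
a `Y`-path from `d` at `ω₁` reaches the outside only through pocket edges and outside edges,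
which are unchanged. -/
lemma cluster_norm_subset {y : V} (hyK : y ∉ K2 (endsD ends d) r s ω)
    (hyM : y ∉ M2 (endsD ends d) r s ω) (hyd : y ≠ d)
    (hy : y ∈ cluster ends (flipTouch (endsD ends d)
      {x : V | x ∈ M2 (endsD ends d) r s ω ∧ x ≠ r ∧ x ≠ s} ω) d) :
    y ∈ cluster ends ω d := by
  set W := {x : V | x ∈ M2 (endsD ends d) r s ω ∧ x ≠ r ∧ x ≠ s} with hW
  set ω₁ := flipTouch (endsD ends d) W ω with hω₁
  have key : y ∈ {z | (z ∈ K2 (endsD ends d) r s ω ∨ z ∈ M2 (endsD ends d) r s ω ∨ z = d) ∨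
      ((z ∉ K2 (endsD ends d) r s ω ∧ z ∉ M2 (endsD ends d) r s ω ∧ z ≠ d) ∧
        Conn ends ω d z)} := by
    refine mem_of_conn_of_closed ?_ (Or.inl (Or.inr (Or.inr rfl))) hy
    rintro a ha b hab
    obtain ⟨hne, e, he, hends⟩ := openGraph_adj.1 hab
    simp only [Set.mem_setOf_eq] at ha ⊢
    by_cases hbU : b ∈ K2 (endsD ends d) r s ω ∨ b ∈ M2 (endsD ends d) r s ω ∨ b = d
    · exact Or.inl hbU
    · right
      simp only [not_or] at hbU
      refine ⟨⟨hbU.1, hbU.2.1, hbU.2.2⟩, ?_⟩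
      -- the edge into the outside vertex `b` is unchanged: it touches no `W`-side vertex
      have hnt : e ∉ touches (endsD ends d) W := by
        rintro ⟨z, hz, w, hzw⟩
        have hzd : z ≠ d := by rintro rfl; exact not_mem_M2_endsD hdr hds ω hz.1
        have hde : d ∉ ends e := by
          intro hde
          rw [endsD_of_mem hde, Sym2.eq_iff] at hzw
          rcases hzw with ⟨h1, _⟩ | ⟨_, h1⟩ <;> exact hzd h1.symm
        rw [endsD_of_notMem hde, hends, Sym2.eq_iff] at hzw
        rcases hzw with ⟨h1, h2⟩ | ⟨h1, h2⟩
        · -- `a ∈ W`: its edge to the outside vertex `b` is `Y` at `ω` — but then at `ω₁` it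
          -- is `W`, not open
          have haW : a ∈ W := h1 ▸ hz
          have := (wside_attachment hdr hds hD hK hends haW hbU.1 hbU.2.1 hbU.2.2).1
          rw [hω₁, flipTouch_of_mem _ ⟨a, haW, b, by rw [endsD_of_notMem hde, hends]⟩, this] at he
          exact absurd he (by decide)
        · exact hbU.2.1 (h2 ▸ hz.1)
      rw [hω₁, flipTouch_of_notMem _ hnt] at he
      rcases ha with (haK | haM | had) | ⟨_, hac⟩
      · -- from a `Y`-side vertex to the outside: the edge is `W` at `ω`
        exfalso
        have had : a ≠ d := by rintro rfl; exact not_mem_K2_endsD hdr hds ω haK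
        have hde : d ∉ ends e := notMem_of_ends_ne hends had hbU.2.2
        exact hbU.1 (mem_K2_of_open haK he (by rw [endsD_of_notMem hde, hends]))
      · -- from `r, s` (the `W`-side is excluded by `hnt`): no edge to the outside
        exfalso
        have hars : a = r ∨ a = s := by
          by_contra h
          exact hnt ⟨a, ⟨haM, fun h' => h (Or.inl h'), fun h' => h (Or.inr h')⟩, b, by
            have had : a ≠ d := by rintro rfl; exact not_mem_M2_endsD hdr hds ω haM
            rw [endsD_of_notMem (notMem_of_ends_ne hends had hbU.2.2), hends]⟩
        have had : a ≠ d := by rintro rfl; rcases hars with h | h; exact hdr h; exact hds h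
        have hde : d ∉ ends e := notMem_of_ends_ne hends had hbU.2.2
        rcases mem_U2_endsD_of_edge_rs (sep2_endsD_of_sep2 hsep) hde hends hars with h' | h'
        · exact hbU.1 h'
        · exact hbU.2.1 h'
      · subst a
        exact conn_of_openAdj ⟨e, he, hends⟩
      · exact conn_trans hac (conn_of_openAdj ⟨e, he, hends⟩)
  simp only [Set.mem_setOf_eq] at key
  rcases key with (h | h | h) | ⟨_, h⟩
  · exact (hyK h).elim
  · exact (hyM h).elim
  · exact (hyd h).elim
  · exact h

include hdr hds hrs hT hsep hD in
/-- **After the switch, `r` and `s` have no closed edge**: the root edges of the `W`-side are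
flipped to `Y`, the other root edges are `Y` already. -/
lemma cluster_compl_mark_norm {t : V} (ht : t = r ∨ t = s) :
    cluster ends (OneColourSwitch.compl (flipTouch (endsD ends d)
      {x : V | x ∈ M2 (endsD ends d) r s ω ∧ x ≠ r ∧ x ≠ s} ω)) t = {t} := by
  set W := {x : V | x ∈ M2 (endsD ends d) r s ω ∧ x ≠ r ∧ x ≠ s} with hW
  set ω₁ := flipTouch (endsD ends d) W ω with hω₁
  have hsepD := sep2_endsD_of_sep2 (d := d) hsep
  have hDz := DZero_endsD_of_DOne hdr hds hD
  have htd : t ≠ d := by rcases ht with rfl | rfl; exact hdr.symm; exact hds.symm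
  have htW : t ∉ W := by rcases ht with rfl | rfl; exact fun h => h.2.1 rfl; exact fun h => h.2.2 rfl
  ext y
  simp only [Set.mem_singleton_iff, mem_cluster]
  constructor
  · intro hy
    have key : y ∈ {z | z = t} := by
      refine mem_of_conn_of_closed ?_ rfl hy
      rintro a ha b hab
      simp only [Set.mem_setOf_eq] at ha ⊢
      subst ha
      exfalso
      obtain ⟨hne, e, he, hends⟩ := openGraph_adj.1 hab
      have he' : ω₁ e = false := by
        simp only [OneColourSwitch.compl, Bool.not_eq_true'] at he; exact he
      have hbrs : ¬ (b = r ∨ b = s) := by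
        intro hb
        have : e ∈ within ends ({r, s} : Set V) := by
          refine ⟨a, ?_, b, ?_, hends⟩
          · rcases ht with rfl | rfl <;> simp
          · rcases hb with rfl | rfl <;> simp
        rw [hrs] at this; exact this
      have hbd : b ≠ d := by
        rintro rfl
        rcases ht with rfl | rfl
        · exact (hT e).1 (by rw [hends, Sym2.eq_swap])
        · exact (hT e).2 (by rw [hends, Sym2.eq_swap])
      have hde : d ∉ ends e := notMem_of_ends_ne hends htd hbd
      have haM : a ∈ M2 (endsD ends d) r s ω := by
        rcases ht with rfl | rfl
        · exact r_mem_M2 a s ω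
        · exact s_mem_M2 r a ω
      have haK : a ∈ K2 (endsD ends d) r s ω := by
        rcases ht with rfl | rfl
        · exact r_mem_K2 a s ω
        · exact s_mem_K2 r a ω
      by_cases hbW : b ∈ W
      · -- the root edge of a `W`-side block: `W` at `ω`, flipped to `Y`
        rw [hω₁, flipTouch_of_mem _ ⟨b, hbW, a, by rw [endsD_of_notMem hde, hends, Sym2.eq_swap]⟩]
          at he'
        have hρe : ω e = true := by
          cases h : ω e
          · rw [h] at he'; exact absurd he' (by decide)
          · rfl
        exact hDz b (fun h => hbrs (Or.inl h)) (fun h => hbrs (Or.inr h))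
          (mem_K2_of_open haK hρe (by rw [endsD_of_notMem hde, hends])) hbW.1
      · -- an unchanged edge: `W` at `ω`, so `b` is `W`-side or `r, s`
        have hnt : e ∉ touches (endsD ends d) W := by
          rintro ⟨z, hz, w, hzw⟩
          rw [endsD_of_notMem hde, hends, Sym2.eq_iff] at hzw
          rcases hzw with ⟨h1, _⟩ | ⟨_, h1⟩
          · exact htW (h1 ▸ hz)
          · exact hbW (h1 ▸ hz)
        rw [hω₁, flipTouch_of_notMem _ hnt] at he'
        have hbM : b ∈ M2 (endsD ends d) r s ω :=
          mem_M2_of_closed haM he' (by rw [endsD_of_notMem hde, hends])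
        exact hbW ⟨hbM, fun h => hbrs (Or.inl h), fun h => hbrs (Or.inr h)⟩
    exact key
  · rintro rfl
    exact conn_refl _ _ _

include hdr hds hsep hD hK hM in
/-- **After the switch, the `Y`-world of `{r, s}` lies in the sided set, `{r, s, d}` and the
cluster of `d` at `ω`**: the switched blocks cannot be left towards the outside. -/
lemma K2_norm_subset :
    K2 ends r s (flipTouch (endsD ends d)
      {x : V | x ∈ M2 (endsD ends d) r s ω ∧ x ≠ r ∧ x ≠ s} ω) ⊆
      {z | z ∈ K2 (endsD ends d) r s ω ∨ z ∈ M2 (endsD ends d) r s ω ∨ z = d ∨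
        z ∈ cluster ends ω d} := by
  set W := {x : V | x ∈ M2 (endsD ends d) r s ω ∧ x ≠ r ∧ x ≠ s} with hW
  set ω₁ := flipTouch (endsD ends d) W ω with hω₁
  have hsepD := sep2_endsD_of_sep2 (d := d) hsep
  intro x hx
  have key : ∀ t, (t = r ∨ t = s) → Conn ends ω₁ t x →
      x ∈ {z | z ∈ K2 (endsD ends d) r s ω ∨ z ∈ M2 (endsD ends d) r s ω ∨ z = d ∨
        z ∈ cluster ends ω d} := by
    intro t ht hc
    refine mem_of_conn_of_closed ?_ (by
      rcases ht with rfl | rfl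
      · exact Or.inl (r_mem_K2 t s ω)
      · exact Or.inl (s_mem_K2 r t ω)) hc
    rintro a ha b hab
    obtain ⟨hne, e, he, hends⟩ := openGraph_adj.1 hab
    simp only [Set.mem_setOf_eq] at ha ⊢
    by_cases hbU : b ∈ K2 (endsD ends d) r s ω ∨ b ∈ M2 (endsD ends d) r s ω ∨ b = d
    · rcases hbU with h | h | h
      · exact Or.inl h
      · exact Or.inr (Or.inl h)
      · exact Or.inr (Or.inr (Or.inl h))
    simp only [not_or] at hbU
    -- `b` is an outside vertex: the edge is unchanged (no `W`-side endpoint) — an outside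
    -- vertex is reached only from `d` or from the cluster
    right; right; right
    have hnt : e ∉ touches (endsD ends d) W := by
      rintro ⟨z, hz, w, hzw⟩
      have hzd : z ≠ d := by rintro rfl; exact not_mem_M2_endsD hdr hds ω hz.1
      have hde : d ∉ ends e := by
        intro hde
        rw [endsD_of_mem hde, Sym2.eq_iff] at hzw
        rcases hzw with ⟨h1, _⟩ | ⟨_, h1⟩ <;> exact hzd h1.symm
      rw [endsD_of_notMem hde, hends, Sym2.eq_iff] at hzw
      rcases hzw with ⟨h1, h2⟩ | ⟨h1, h2⟩
      · have haW : a ∈ W := h1 ▸ hz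
        have := (wside_attachment hdr hds hD hK hends haW hbU.1 hbU.2.1 hbU.2.2).1
        rw [hω₁, flipTouch_of_mem _ ⟨a, haW, b, by rw [endsD_of_notMem hde, hends]⟩, this] at he
        exact absurd he (by decide)
      · exact hbU.2.1 (h2 ▸ hz.1)
    rw [hω₁, flipTouch_of_notMem _ hnt] at he
    rcases ha with haK | haM | had | haC
    · exfalso
      have had : a ≠ d := by rintro rfl; exact not_mem_K2_endsD hdr hds ω haK
      have hde : d ∉ ends e := notMem_of_ends_ne hends had hbU.2.2
      exact hbU.1 (mem_K2_of_open haK he (by rw [endsD_of_notMem hde, hends]))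
    · exfalso
      have had : a ≠ d := by rintro rfl; exact not_mem_M2_endsD hdr hds ω haM
      have hde : d ∉ ends e := notMem_of_ends_ne hends had hbU.2.2
      have hars : a = r ∨ a = s := by
        by_contra h
        exact hnt ⟨a, ⟨haM, fun h' => h (Or.inl h'), fun h' => h (Or.inr h')⟩, b,
          by rw [endsD_of_notMem hde, hends]⟩
      rcases mem_U2_endsD_of_edge_rs hsepD hde hends hars with h' | h'
      · exact hbU.1 h'
      · exact hbU.2.1 h'
    · subst a
      exact conn_of_openAdj ⟨e, he, hends⟩
    · exact conn_trans haC (conn_of_openAdj ⟨e, he, hends⟩)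
  rcases mem_K2_iff.1 hx with hc | hc
  · exact key r (Or.inl rfl) hc
  · exact key s (Or.inr rfl) hc

include hdr hds hrs hT hsep hD hK hM in
/-- **The switched point is a `K`-only legal point without a `W`-side.** -/
lemma norm_legal (hp : p ≠ d) (hq : q ≠ d) :
    sep2 ends p q r s (flipTouch (endsD ends d)
        {x : V | x ∈ M2 (endsD ends d) r s ω ∧ x ≠ r ∧ x ≠ s} ω) ∧
      DOne ends r s d (flipTouch (endsD ends d)
        {x : V | x ∈ M2 (endsD ends d) r s ω ∧ x ≠ r ∧ x ≠ s} ω) ∧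
      d ∈ K2 ends r s (flipTouch (endsD ends d)
        {x : V | x ∈ M2 (endsD ends d) r s ω ∧ x ≠ r ∧ x ≠ s} ω) ∧
      d ∉ M2 ends r s (flipTouch (endsD ends d)
        {x : V | x ∈ M2 (endsD ends d) r s ω ∧ x ≠ r ∧ x ≠ s} ω) := by
  set W := {x : V | x ∈ M2 (endsD ends d) r s ω ∧ x ≠ r ∧ x ≠ s} with hW
  set ω₁ := flipTouch (endsD ends d) W ω with hω₁
  have hsepD := sep2_endsD_of_sep2 (d := d) hsep
  have hM2 : ∀ x, x ∈ M2 ends r s ω₁ → x = r ∨ x = s := by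
    intro x hx
    rcases mem_M2_iff.1 hx with hc | hc
    · have := cluster_compl_mark_norm hdr hds hrs hT hsep hD (Or.inl rfl)
      have hx' : x ∈ cluster ends (OneColourSwitch.compl ω₁) r := hc
      rw [this] at hx'; exact Or.inl hx'
    · have := cluster_compl_mark_norm hdr hds hrs hT hsep hD (Or.inr rfl)
      have hx' : x ∈ cluster ends (OneColourSwitch.compl ω₁) s := hc
      rw [this] at hx'; exact Or.inr hx'
  have hK2 := K2_norm_subset hdr hds hsep hD hK hM
  obtain ⟨⟨hpK, hqK⟩, ⟨hpM, hqM⟩⟩ := sep2_iff.1 hsepD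
  obtain ⟨⟨hpK', hqK'⟩, ⟨hpM', hqM'⟩⟩ := sep2_iff.1 hsep
  have hcl : ∀ x, x ∈ cluster ends ω d → x ∈ K2 ends r s ω := by
    intro x hx
    rcases mem_K2_iff.1 hK with hc | hc
    · exact mem_K2_iff.2 (Or.inl (conn_trans hc hx))
    · exact mem_K2_iff.2 (Or.inr (conn_trans hc hx))
  refine ⟨?_, ?_, ?_, ?_⟩
  · rw [sep2_iff]
    refine ⟨⟨fun h => ?_, fun h => ?_⟩, ⟨fun h => ?_, fun h => ?_⟩⟩
    · rcases hK2 h with h' | h' | h' | h'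
      · exact hpK h'
      · exact hpM h'
      · exact hp h'
      · exact hpK' (hcl p h')
    · rcases hK2 h with h' | h' | h' | h'
      · exact hqK h'
      · exact hqM h'
      · exact hq h'
      · exact hqK' (hcl q h')
    · rcases hM2 p h with h' | h'
      · exact hpM' (by rw [h']; exact r_mem_M2 r s ω)
      · exact hpM' (by rw [h']; exact s_mem_M2 r s ω)
    · rcases hM2 q h with h' | h'
      · exact hqM' (by rw [h']; exact r_mem_M2 r s ω)
      · exact hqM' (by rw [h']; exact s_mem_M2 r s ω)
  · intro x hxr hxs _ _ hxM
    rcases hM2 x hxM with h | h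
    · exact hxr h
    · exact hxs h
  · -- the `Y` edge of `d` into a joined block is unchanged
    obtain ⟨e, y, hey, he, hy⟩ := exists_open_edge_d_of_mem_K2 hdr hds hK
    have hyW : y ∉ W := fun h =>
      DZero_endsD_of_DOne hdr hds hD y h.2.1 h.2.2 hy h.1
    have hnt : e ∉ touches (endsD ends d) W := by
      rintro ⟨z, hz, w, hzw⟩
      rw [endsD_of_mem (by rw [hey]; exact Sym2.mem_mk_left _ _), Sym2.eq_iff] at hzw
      have hzd : z = d := by rcases hzw with ⟨h, _⟩ | ⟨_, h⟩ <;> exact h.symm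
      exact not_mem_M2_endsD hdr hds ω (hzd ▸ hz.1)
    have hyK : y ∈ K2 (endsD ends d) r s ω₁ := by
      rw [hω₁, K2_endsD_norm hdr hds hsep hD]; exact Or.inl hy
    refine mem_K2_of_open (K2_endsD_subset_K2 _ hyK) ?_ (by rw [hey, Sym2.eq_swap])
    rw [hω₁, flipTouch_of_notMem _ hnt]; exact he
  · intro h
    rcases hM2 d h with h' | h'
    · exact hdr h'
    · exact hds h'

end Norm

end NoPocket

end Summit.Ventures.PercRepro2
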